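import Summits.AtomisticToContinuum.Crystallization.Theorems.IsometryAtomsMinimisingLawsHaveAtomsRootEnergyLeOfCopositivityAux
import HarnessLib

/-!
# Second variation of Palm copositivity: the reverse first-order inequality
# (energy-transitivity WITH EQUALITY for line `perron_transfer`, crux `IsometryAtoms.MinimisingLawsHaveAtoms`,
# stmt-AtomisticToContinuum-15776) — auxiliary lemmas

The landed first variation (`…RootEnergyLeOfCopositivity`, p172720) perturbs the constant weight DOWNWARDS,
`w = 1 - s f`, and yields `E_P[f (h' - e*)] ≤ 0` for every measurable `0 ≤ f ≤ 1`.  Perturbing UPWARDS,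
`w = (1 + s f)/2` (still a weight `≤ 1`; copositivity is homogeneous), flips the sign of the first-order term and
yields `E_P[f (h' - e*)] ≥ 0`.  This file: the variation inequality at `w = (1 + s f)/2` in real numbers
(`relc_variation_plus`) and the abstract reverse first-order condition (`relc_first_order_ge`).  Together with the
landed half they give `h = e*` ALMOST SURELY — energy-transitivity with equality (next file).  All `[folklore]`.
-/

noncomputable section

namespace Summit.AtomisticToContinuum.Crystallization.Theorems.IsometryAtomsMinimisingLawsHaveAtoms

open MeasureTheory ProbabilityTheory Set Filter
open scoped ENNReal
open Literature.MathematicalPhysics.StatisticalMechanics (lennardJones rootEnergy PeriodicConfiguration)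
open Literature.Probability.Process (IsRootedHardCore IsPointStationaryLaw)
open Summit.AtomisticToContinuum.Crystallization.Theorems.ChargedEnergyGapNegative (E3 eStar)
open Summit.AtomisticToContinuum.Crystallization.Theorems.UnimodularEnergy (measurable_ofReal_lennardJones_norm
  measurable_ofReal_neg_lennardJones_norm eStar_nonpos)
open Summit.AtomisticToContinuum.Crystallization.Theorems.PalmUnimodularRigidityMinimiserShells.EnergyFloor
  (lintegral_pos_le_of_hc lintegral_neg_le_of_hc)

section VariationPlus

variable {δ : ℝ} {P : Measure (Measure E3)}

/-- **Affine splitting** of a weighted functional: if `w = a + b F` pointwise then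
`∫ w(θ_z) q = a ∫ q + b ∫ F(θ_z) q`. [folklore] -/
theorem relc_split_plus (κ : Kernel (Measure E3) E3) [IsSFiniteKernel κ] {w F : Measure E3 → ℝ≥0∞}
    (hF : Measurable F) {a b : ℝ≥0∞} (hsplit : ∀ ν, w ν = a + b * F ν)
    {q : E3 → ℝ≥0∞} (hq : Measurable q) (μ : Measure E3) :
    ∫⁻ z, w ((κ μ).map (fun x => x - z)) * q z ∂(κ μ) =
      a * ∫⁻ z, q z ∂(κ μ) + b * ∫⁻ z, F ((κ μ).map (fun x => x - z)) * q z ∂(κ μ) := by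
  rw [← lintegral_const_mul _ hq, ← lintegral_const_mul _ (relc_measurable_section κ hF hq μ),
    ← lintegral_add_left (hq.const_mul a)]
  refine lintegral_congr fun z => ?_
  rw [hsplit, add_mul, mul_assoc]

/-- **Copositivity at `w = (1 + s f)/2`, in real numbers.** With `ap, am, fp, fm` the real parts of the (kernel
versions of the) functionals `∫ V⁺`, `∫ V⁻`, `∫ F(θ_z)V⁺`, `∫ F(θ_z)V⁻` (`F = ofReal ∘ f`, `0 ≤ f ≤ 1`,
`0 < s ≤ 1`): `∫ ((1+sf)/2)(am/2 + (s/2) fm) ≤ ∫ ((1+sf)/2)(ap/2 + (s/2) fp) + 2(-e*) ∫ ((1+sf)/2)²`. [folklore] -/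
theorem relc_variation_plus [IsProbabilityMeasure P] (hδ : 0 < δ) (κ : Kernel (Measure E3) E3) [IsSFiniteKernel κ]
    (hκ : ∀ μ : Measure E3, IsRootedHardCore δ μ → κ μ = μ) (hcore : ∀ᵐ μ ∂P, IsRootedHardCore δ μ)
    (hcop : ∀ w : Measure E3 → ℝ≥0∞, Measurable w → (∀ μ, w μ ≤ 1) →
      ∫⁻ μ, w μ * (∫⁻ z, w (Measure.map (fun x => x - z) μ) * ENNReal.ofReal (-lennardJones ‖z‖) ∂μ) ∂P ≤
        ∫⁻ μ, w μ * (∫⁻ z, w (Measure.map (fun x => x - z) μ) * ENNReal.ofReal (lennardJones ‖z‖) ∂μ) ∂P +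
          2 * ENNReal.ofReal (-eStar) * ∫⁻ μ, (w μ) ^ 2 ∂P)
    {f : Measure E3 → ℝ} (hf : Measurable f) (hf01 : ∀ ν, 0 ≤ f ν ∧ f ν ≤ 1)
    (ap am fp fm : Measure E3 → ℝ)
    (hap : ∀ μ, ap μ = (∫⁻ z, ENNReal.ofReal (lennardJones ‖z‖) ∂(κ μ)).toReal)
    (ham : ∀ μ, am μ = (∫⁻ z, ENNReal.ofReal (-lennardJones ‖z‖) ∂(κ μ)).toReal)
    (hfp : ∀ μ, fp μ = (∫⁻ z, ENNReal.ofReal (f ((κ μ).map (fun x => x - z))) *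
      ENNReal.ofReal (lennardJones ‖z‖) ∂(κ μ)).toReal)
    (hfm : ∀ μ, fm μ = (∫⁻ z, ENNReal.ofReal (f ((κ μ).map (fun x => x - z))) *
      ENNReal.ofReal (-lennardJones ‖z‖) ∂(κ μ)).toReal)
    {s : ℝ} (hs : 0 < s) (hs1 : s ≤ 1) :
    ∫ μ, ((1 + s * f μ) / 2) * (am μ / 2 + (s / 2) * fm μ) ∂P ≤
      ∫ μ, ((1 + s * f μ) / 2) * (ap μ / 2 + (s / 2) * fp μ) ∂P +
        2 * (-eStar) * ∫ μ, ((1 + s * f μ) / 2) ^ 2 ∂P := by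
  -- fields and weights
  obtain ⟨p, hp_def⟩ : ∃ p : E3 → ℝ≥0∞, p = fun z => ENNReal.ofReal (lennardJones ‖z‖) := ⟨_, rfl⟩
  obtain ⟨m, hm_def⟩ : ∃ m : E3 → ℝ≥0∞, m = fun z => ENNReal.ofReal (-lennardJones ‖z‖) := ⟨_, rfl⟩
  have hp : Measurable p := hp_def ▸ measurable_ofReal_lennardJones_norm
  have hm : Measurable m := hm_def ▸ measurable_ofReal_neg_lennardJones_norm
  obtain ⟨F, hF_def⟩ : ∃ F : Measure E3 → ℝ≥0∞, F = fun ν => ENNReal.ofReal (f ν) := ⟨_, rfl⟩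
  have hF : Measurable F := hF_def ▸ ENNReal.measurable_ofReal.comp hf
  have hF1 : ∀ ν, F ν ≤ 1 := fun ν => by rw [hF_def]; exact ENNReal.ofReal_le_one.2 (hf01 ν).2
  obtain ⟨wr, hwr_def⟩ : ∃ wr : Measure E3 → ℝ, wr = fun ν => (1 + s * f ν) / 2 := ⟨_, rfl⟩
  have hwr01 : ∀ ν, 0 ≤ wr ν ∧ wr ν ≤ 1 := fun ν => by
    have := hf01 ν
    rw [hwr_def]
    constructor <;> nlinarith
  have hwrm : Measurable wr := hwr_def ▸ (measurable_const.add (hf.const_mul s)).div_const 2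
  obtain ⟨w, hw_def⟩ : ∃ w : Measure E3 → ℝ≥0∞, w = fun ν => ENNReal.ofReal (wr ν) := ⟨_, rfl⟩
  have hw : Measurable w := hw_def ▸ ENNReal.measurable_ofReal.comp hwrm
  have hw1 : ∀ ν, w ν ≤ 1 := fun ν => by rw [hw_def]; exact ENNReal.ofReal_le_one.2 (hwr01 ν).2
  have hwreal : ∀ ν, (w ν).toReal = (1 + s * f ν) / 2 := fun ν => by
    rw [hw_def, ENNReal.toReal_ofReal (hwr01 ν).1, hwr_def]
  have hsplit : ∀ ν, w ν = ENNReal.ofReal (1 / 2) + ENNReal.ofReal (s / 2) * F ν := fun ν => by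
    rw [hw_def, hF_def, hwr_def]
    dsimp only
    rw [← ENNReal.ofReal_mul (by positivity), ← ENNReal.ofReal_add (by norm_num)
      (by nlinarith [(hf01 ν).1, hs.le])]
    congr 1; ring
  -- kernel versions of the weighted functionals
  obtain ⟨Wp, hWp_def⟩ : ∃ Wp : Measure E3 → ℝ≥0∞,
      Wp = fun μ => ∫⁻ z, w ((κ μ).map (fun x => x - z)) * p z ∂(κ μ) := ⟨_, rfl⟩
  obtain ⟨Wm, hWm_def⟩ : ∃ Wm : Measure E3 → ℝ≥0∞,
      Wm = fun μ => ∫⁻ z, w ((κ μ).map (fun x => x - z)) * m z ∂(κ μ) := ⟨_, rfl⟩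
  have hWpm : Measurable Wp := hWp_def ▸ relc_measurable_weighted κ hw hp
  have hWmm : Measurable Wm := hWm_def ▸ relc_measurable_weighted κ hw hm
  have hWp_le : ∀ μ, Wp μ ≤ ∫⁻ z, p z ∂(κ μ) := fun μ => by rw [hWp_def]; exact relc_weighted_le κ hw1 p μ
  have hWm_le : ∀ μ, Wm μ ≤ ∫⁻ z, m z ∂(κ μ) := fun μ => by rw [hWm_def]; exact relc_weighted_le κ hw1 m μ
  -- copositivity at `w`, kernel versions inside
  have hcw : ∫⁻ μ, w μ * Wm μ ∂P ≤ ∫⁻ μ, w μ * Wp μ ∂P + 2 * ENNReal.ofReal (-eStar) * ∫⁻ μ, (w μ) ^ 2 ∂P := by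
    have h := hcop w hw hw1
    have hL : ∫⁻ μ, w μ * (∫⁻ z, w (Measure.map (fun x => x - z) μ) * ENNReal.ofReal (-lennardJones ‖z‖) ∂μ) ∂P =
        ∫⁻ μ, w μ * Wm μ ∂P := by
      refine lintegral_congr_ae ?_
      filter_upwards [hcore] with μ hμ
      rw [hWm_def, hm_def]
      dsimp only
      rw [hκ μ hμ]
    have hR : ∫⁻ μ, w μ * (∫⁻ z, w (Measure.map (fun x => x - z) μ) * ENNReal.ofReal (lennardJones ‖z‖) ∂μ) ∂P =
        ∫⁻ μ, w μ * Wp μ ∂P := by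
      refine lintegral_congr_ae ?_
      filter_upwards [hcore] with μ hμ
      rw [hWp_def, hp_def]
      dsimp only
      rw [hκ μ hμ]
    rwa [hL, hR] at h
  -- uniform bounds
  set cp : ℝ := 250 / 12 * δ⁻¹ ^ 12 with hcp
  set cm : ℝ := 250 / 6 * δ⁻¹ ^ 6 with hcm
  have hcp0 : 0 ≤ cp := by positivity
  have hcm0 : 0 ≤ cm := by positivity
  have hbAp : ∀ᵐ μ ∂P, ∫⁻ z, p z ∂(κ μ) ≤ ENNReal.ofReal cp := by
    filter_upwards [hcore] with μ hμ
    rw [hκ μ hμ, hp_def]; exact lintegral_pos_le_of_hc hδ hμ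
  have hbAm : ∀ᵐ μ ∂P, ∫⁻ z, m z ∂(κ μ) ≤ ENNReal.ofReal cm := by
    filter_upwards [hcore] with μ hμ
    rw [hκ μ hμ, hm_def]; exact lintegral_neg_le_of_hc hδ hμ
  have hbL : ∀ᵐ μ ∂P, w μ * Wm μ ≤ ENNReal.ofReal cm := hbAm.mono fun μ h =>
    (mul_le_mul' (hw1 μ) ((hWm_le μ).trans h)).trans_eq (one_mul _)
  have hbR : ∀ᵐ μ ∂P, w μ * Wp μ ≤ ENNReal.ofReal cp := hbAp.mono fun μ h =>
    (mul_le_mul' (hw1 μ) ((hWp_le μ).trans h)).trans_eq (one_mul _)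
  have hbQ : ∀ᵐ μ ∂P, (w μ) ^ 2 ≤ ENNReal.ofReal 1 := ae_of_all _ fun μ => by
    rw [ENNReal.ofReal_one]; exact pow_le_one' (hw1 μ) 2
  obtain ⟨-, -, hLe, -⟩ := relc_pack (G := fun μ => w μ * Wm μ) (hw.mul hWmm) hcm0 hbL
  obtain ⟨-, -, hRe, hRfin⟩ := relc_pack (G := fun μ => w μ * Wp μ) (hw.mul hWpm) hcp0 hbR
  obtain ⟨-, -, hQe, hQfin⟩ := relc_pack (G := fun μ => (w μ) ^ 2) (hw.pow_const 2) zero_le_one hbQ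
  -- pass to real numbers
  have he0 : 0 ≤ -eStar := neg_nonneg.2 eStar_nonpos
  have hc_fin : 2 * ENNReal.ofReal (-eStar) ≠ ∞ := ENNReal.mul_ne_top (by simp) ENNReal.ofReal_ne_top
  have hreal : (∫⁻ μ, w μ * Wm μ ∂P).toReal ≤
      (∫⁻ μ, w μ * Wp μ ∂P).toReal + 2 * (-eStar) * (∫⁻ μ, (w μ) ^ 2 ∂P).toReal := by
    have h := ENNReal.toReal_mono (ENNReal.add_ne_top.2 ⟨hRfin, ENNReal.mul_ne_top hc_fin hQfin⟩) hcw
    rwa [ENNReal.toReal_add hRfin (ENNReal.mul_ne_top hc_fin hQfin), ENNReal.toReal_mul,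
      ENNReal.toReal_mul, ENNReal.toReal_ofReal he0, ENNReal.toReal_ofNat] at h
  rw [← hLe, ← hRe, ← hQe] at hreal
  -- the affine splitting in real numbers
  have hfF : ∀ μ z, ENNReal.ofReal (f ((κ μ).map (fun x => x - z))) = F ((κ μ).map (fun x => x - z)) :=
    fun μ z => by rw [hF_def]
  have htoReal : ∀ {q : E3 → ℝ≥0∞} (_ : Measurable q) (μ : Measure E3), ∫⁻ z, q z ∂(κ μ) ≠ ∞ →
      (∫⁻ z, w ((κ μ).map (fun x => x - z)) * q z ∂(κ μ)).toReal =
        (∫⁻ z, q z ∂(κ μ)).toReal / 2 + (s / 2) * (∫⁻ z, F ((κ μ).map (fun x => x - z)) * q z ∂(κ μ)).toReal := by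
    intro q hq μ hfin
    have hfin' : ∫⁻ z, F ((κ μ).map (fun x => x - z)) * q z ∂(κ μ) ≠ ∞ :=
      ne_top_of_le_ne_top hfin (relc_weighted_le κ hF1 q μ)
    rw [relc_split_plus κ hF hsplit hq μ, ENNReal.toReal_add (ENNReal.mul_ne_top ENNReal.ofReal_ne_top hfin)
      (ENNReal.mul_ne_top ENNReal.ofReal_ne_top hfin'), ENNReal.toReal_mul, ENNReal.toReal_mul,
      ENNReal.toReal_ofReal (by norm_num), ENNReal.toReal_ofReal (by positivity)]
    ring
  have hLi : ∫ μ, (w μ * Wm μ).toReal ∂P = ∫ μ, ((1 + s * f μ) / 2) * (am μ / 2 + (s / 2) * fm μ) ∂P := by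
    refine integral_congr_ae ?_
    filter_upwards [hbAm] with μ h
    have hfin : ∫⁻ z, m z ∂(κ μ) ≠ ∞ := ne_top_of_le_ne_top ENNReal.ofReal_ne_top h
    rw [ENNReal.toReal_mul, hwreal, hWm_def, ham, hfm]
    dsimp only
    rw [htoReal hm μ hfin, hm_def]
    simp only [hfF]
  have hRi : ∫ μ, (w μ * Wp μ).toReal ∂P = ∫ μ, ((1 + s * f μ) / 2) * (ap μ / 2 + (s / 2) * fp μ) ∂P := by
    refine integral_congr_ae ?_
    filter_upwards [hbAp] with μ h
    have hfin : ∫⁻ z, p z ∂(κ μ) ≠ ∞ := ne_top_of_le_ne_top ENNReal.ofReal_ne_top h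
    rw [ENNReal.toReal_mul, hwreal, hWp_def, hap, hfp]
    dsimp only
    rw [htoReal hp μ hfin, hp_def]
    simp only [hfF]
  have hQi : ∫ μ, ((w μ) ^ 2).toReal ∂P = ∫ μ, ((1 + s * f μ) / 2) ^ 2 ∂P := by
    refine integral_congr_ae (ae_of_all _ fun μ => ?_)
    simp only [ENNReal.toReal_pow, hwreal]
  rw [hLi, hRi, hQi] at hreal
  exact hreal

/-- **The reverse first-order condition, abstract form.** Same data as `relc_first_order`, but with the variation
inequality at the UPWARD perturbation `w = (1 + s f)/2`; conclusion `0 ≤ ∫ f ((ap - am)/2 - e)`. [folklore] -/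
theorem relc_first_order_ge {α : Type*} [MeasurableSpace α] {μ : Measure α} [IsProbabilityMeasure μ]
    {f ap am fp fm : α → ℝ} {e C : ℝ}
    (hf_i : Integrable f μ) (hap_i : Integrable ap μ) (ham_i : Integrable am μ)
    (hfp_i : Integrable fp μ) (hfm_i : Integrable fm μ)
    (hfap_i : Integrable (fun x => f x * ap x) μ) (hfam_i : Integrable (fun x => f x * am x) μ)
    (hffp_i : Integrable (fun x => f x * fp x) μ) (hffm_i : Integrable (fun x => f x * fm x) μ)
    (hff_i : Integrable (fun x => f x * f x) μ)
    (hMp : ∫ x, fp x ∂μ = ∫ x, f x * ap x ∂μ) (hMm : ∫ x, fm x ∂μ = ∫ x, f x * am x ∂μ)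
    (hmin : ∫ x, (ap x - am x) ∂μ ≤ 2 * e)
    (hG2 : ∫ x, f x * fp x ∂μ - ∫ x, f x * fm x ∂μ - 2 * e * ∫ x, f x * f x ∂μ ≤ C) (hC : 0 < C)
    (hvar : ∀ s : ℝ, 0 < s → s ≤ 1 / 2 →
      ∫ x, ((1 + s * f x) / 2) * (am x / 2 + (s / 2) * fm x) ∂μ ≤
        ∫ x, ((1 + s * f x) / 2) * (ap x / 2 + (s / 2) * fp x) ∂μ +
          2 * (-e) * ∫ x, ((1 + s * f x) / 2) ^ 2 ∂μ) :
    0 ≤ ∫ x, f x * ((ap x - am x) / 2 - e) ∂μ := by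
  set J : ℝ := ∫ x, f x * ((ap x - am x) / 2 - e) ∂μ with hJ_def
  have hJ : J = (∫ x, f x * ap x ∂μ - ∫ x, f x * am x ∂μ) / 2 - e * ∫ x, f x ∂μ := by
    have h1 : J = ∫ x, ((f x * ap x - f x * am x) / 2 - e * f x) ∂μ :=
      integral_congr_ae (ae_of_all _ fun x => by ring)
    have i1 : Integrable (fun x => (f x * ap x - f x * am x) / 2) μ := (hfap_i.sub hfam_i).div_const 2
    have i2 : Integrable (fun x => e * f x) μ := hf_i.const_mul e
    rw [h1, integral_sub i1 i2, integral_div, integral_sub hfap_i hfam_i, integral_const_mul]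
  have hkey : ∀ s : ℝ, 0 < s → s ≤ 1 / 2 → -(s * C / 4) ≤ J := by
    intro s hs hs2
    have hv := hvar s hs hs2
    have eL : ∫ x, ((1 + s * f x) / 2) * (am x / 2 + (s / 2) * fm x) ∂μ =
        (∫ x, am x ∂μ + s * ∫ x, fm x ∂μ + s * ∫ x, f x * am x ∂μ + s ^ 2 * ∫ x, f x * fm x ∂μ) / 4 := by
      have : ∀ x, ((1 + s * f x) / 2) * (am x / 2 + (s / 2) * fm x) =
          (am x + s * fm x + s * (f x * am x) + s ^ 2 * (f x * fm x)) / 4 := fun x => by ring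
      simp_rw [this]
      have i1 : Integrable (fun x => s * fm x) μ := hfm_i.const_mul s
      have i2 : Integrable (fun x => s * (f x * am x)) μ := hfam_i.const_mul s
      have i3 : Integrable (fun x => s ^ 2 * (f x * fm x)) μ := hffm_i.const_mul _
      have i4 : Integrable (fun x => am x + s * fm x) μ := ham_i.add i1
      have i5 : Integrable (fun x => am x + s * fm x + s * (f x * am x)) μ := i4.add i2
      rw [integral_div, integral_add i5 i3, integral_add i4 i2, integral_add ham_i i1, integral_const_mul,
        integral_const_mul, integral_const_mul]
    have eR : ∫ x, ((1 + s * f x) / 2) * (ap x / 2 + (s / 2) * fp x) ∂μ =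
        (∫ x, ap x ∂μ + s * ∫ x, fp x ∂μ + s * ∫ x, f x * ap x ∂μ + s ^ 2 * ∫ x, f x * fp x ∂μ) / 4 := by
      have : ∀ x, ((1 + s * f x) / 2) * (ap x / 2 + (s / 2) * fp x) =
          (ap x + s * fp x + s * (f x * ap x) + s ^ 2 * (f x * fp x)) / 4 := fun x => by ring
      simp_rw [this]
      have i1 : Integrable (fun x => s * fp x) μ := hfp_i.const_mul s
      have i2 : Integrable (fun x => s * (f x * ap x)) μ := hfap_i.const_mul s
      have i3 : Integrable (fun x => s ^ 2 * (f x * fp x)) μ := hffp_i.const_mul _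
      have i4 : Integrable (fun x => ap x + s * fp x) μ := hap_i.add i1
      have i5 : Integrable (fun x => ap x + s * fp x + s * (f x * ap x)) μ := i4.add i2
      rw [integral_div, integral_add i5 i3, integral_add i4 i2, integral_add hap_i i1, integral_const_mul,
        integral_const_mul, integral_const_mul]
    have eQ : ∫ x, ((1 + s * f x) / 2) ^ 2 ∂μ = (1 + 2 * s * ∫ x, f x ∂μ + s ^ 2 * ∫ x, f x * f x ∂μ) / 4 := by
      have : ∀ x, ((1 + s * f x) / 2) ^ 2 = ((1 : ℝ) + 2 * s * f x + s ^ 2 * (f x * f x)) / 4 := fun x => by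
        ring
      simp_rw [this]
      have i1 : Integrable (fun x => 2 * s * f x) μ := hf_i.const_mul _
      have i2 : Integrable (fun x => s ^ 2 * (f x * f x)) μ := hff_i.const_mul _
      have i4 : Integrable (fun x => (1 : ℝ) + 2 * s * f x) μ := (integrable_const 1).add i1
      rw [integral_div, integral_add i4 i2, integral_add (integrable_const 1) i1, integral_const_mul,
        integral_const_mul, integral_const]
      simp
    have eApm : ∫ x, ap x ∂μ - ∫ x, am x ∂μ ≤ 2 * e := by
      rw [← integral_sub hap_i ham_i]; exact hmin
    rw [eL, eR, eQ, hMp, hMm] at hv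
    have h4 : -(s ^ 2 * C) ≤ 4 * s * J := by
      rw [hJ]
      nlinarith [hv, eApm, mul_le_mul_of_nonneg_left hG2 (sq_nonneg s)]
    have h5 : s * (-(s * C)) ≤ s * (4 * J) := by nlinarith [h4]
    have h6 := le_of_mul_le_mul_left h5 hs
    linarith
  by_contra hJge
  have hJneg : J < 0 := not_le.1 hJge
  set s : ℝ := min (1 / 2) (2 * (-J) / C) with hs_def
  have hJ' : 0 < -J := by linarith
  have hs : 0 < s := lt_min (by norm_num) (by positivity)
  have h1 := hkey s hs (min_le_left _ _)
  have h2 : s * C ≤ 2 * (-J) := by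
    have hsJ : s ≤ 2 * (-J) / C := min_le_right _ _
    rwa [le_div_iff₀ hC] at hsJ
  linarith

end VariationPlus

end Summit.AtomisticToContinuum.Crystallization.Theorems.IsometryAtomsMinimisingLawsHaveAtoms

end
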